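import Literature.NumberTheory.EllipticCurves.ComplexMultiplicationHasCMProofs
import Literature.NumberTheory.EllipticCurves.CMTorsionTwistCharacterProofs
import Literature.NumberTheory.EllipticCurves.GeomEndRingTransport
import Literature.NumberTheory.EllipticCurves.Rank1Residual.Predicates
import Summits.BirchSwinnertonDyer.Rank1Residual.X9.GaloisShear
import HarnessLib

/-!
# No elliptic curve over `ℚ` with `j = 1728` has surjective mod-`3` Galois representation
# (cell `b2b-bsdres`, team n1011, seat p14 gen 3 — corner lemma for the EXOTIC residue of X4 at `3`:
# it removes the `padicValRat 3 (j − 1728) = 0` junk disjunct (`j = 1728`) from the two-arm signature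
# of `Additive/X4ExoticWildArms.lean` p264500)

HONEST FRAMING (cell `b2b-bsdres`, run/shared/lean/b2b/bsd-rank1-residual/, verbatim in every
file): the goal of the cell is to DELETE the COMBINATION-SHAPED residual classes of the
Birch–Swinnerton-Dyer formula for ALL analytic-rank `≤ 1` elliptic curves over `ℚ` — "full BSD
formula for every rank `≤ 1` curve in class `C`" assembled STRICTLY from published theorems — so
that the rank-`≤ 1` remainder becomes exactly the CONSTRUCTION-SHAPED classes, which are TYPED
(missing-input `Prop`s), NOT attempted. This is not "finishing BSD". Team n1011 (N10 / N11, the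
additive block X4 ∧ `p = 3`): research route; no claim beyond the stated classes; nothing is booked.
Theorems only (no definition, no named fact).

## What this file proves

* `exists_sq_eq_neg_one_ofJ1728` — on `y² = x³ + x` the automorphism `[i] : (x, y) ↦ (−x, iy)`
  (`i² = −1`; the tree's `smul_ofJ1728_eq` / `toAddMonoidHom_pointEquiv_trans_congrEquiv_mem_geomEndRing`)
  is an element `ψ ∈ End_{ℚ̄}(E)` with `ψ ∘ ψ = [−1]`.
* `exists_sq_eq_neg_one_of_j_eq_1728` — the same on EVERY elliptic `W/ℚ` with `j(W) = 1728`
  (transport of `End_{ℚ̄}` along the `ℚ̄`-isomorphism, `exists_ringEquiv_geomEndRing_of_j_eq`).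
* **`not_surj_three_of_j_eq_1728`** — `j(W) = 1728 ⟹ ¬ Surj W 3`: `ρ̄_{E,3} : Γ_ℚ → Aut E[3]` is
  NOT onto.  Proof: by Lang's Remark (`exists_quadraticTwist_of_sq_eq_intCast`) `ψ(σP) = χ(σ)·σψ(P)`
  with `χ(σ) = ±1`, and this persists on `E[3]` (`exists_restrict_geomTorsion_of_twist`): an
  endomorphism `φ` of `E[3]` with `φ² = −1` and `φσ = ±σφ` for every `σ ∈ Γ_ℚ`.  For `P ≠ 0` the pair
  `(P, φP)` is a `ℤ/3`-frame of `E[3]` (`a P + b φP = 0 ⟹ (a² + b²) P = 0 ⟹ 3 ∣ a² + b² ⟹ a = b = 0`).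
  If `ρ̄_{E,3}` were onto, some `σ` would act by the shear `σP = P`, `σ(φP) = P + φP` (the tree's
  `X9.exists_smul_eq_shear_of_hasSurjectiveModNGaloisRep`); then `φP = φ(σP) = ±σ(φP) = ±(P + φP)`,
  i.e. `P = 0` or `P + 2φP = 0` — both contradict the frame.  (Classically: the image of `Γ_{ℚ(i)}`
  centralises `[i]`, so `ρ̄_{E,3}(Γ_ℚ)` lies in the normaliser of a Cartan subgroup, of index `≥ 3`.)
* `j_ne_1728_of_surj_three` — the contrapositive used on the X4 side.

References: J. H. Silverman, *AEC* (2009), III Example 4.4 and Thm. III.10.1 (`[i]` on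
`y² = x³ + x`), III.1.4(b); S. Lang, *Elliptic Functions* (1987), Ch. 10 §4, Remark; J.-P. Serre,
Invent. Math. 15 (1972) §4.5 (CM images are Cartan normalisers).
-/

noncomputable section

open scoped Classical

open WeierstrassCurve Field Literature.NumberTheory.EllipticCurves
  Literature.NumberTheory.EllipticCurves.Rank1Residual

namespace Summit.BirchSwinnertonDyer.Rank1Residual.GaloisImage

/-! ## §1 `[i]` on `y² = x³ + x` squares to `[−1]` -/

/-- **`[i]² = [−1]` on `y² = x³ + x`.**  For `u ∈ ℚ̄` with `u² = −1` the change of variables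
`(u; 0, 0, 0)` is an automorphism of `y² = x³ + x` over `ℚ̄` (`smul_ofJ1728_eq`); the induced
additive automorphism `ψ : (x, y) ↦ (u⁻²x, u⁻³y) = (−x, uy)` of `E(ℚ̄)` lies in `End_{ℚ̄}(E)` and
`ψ(ψ(x, y)) = (x, −y) = −(x, y)`. [cite: SilvermanAEC2009, III Example 4.4] -/
theorem exists_sq_eq_neg_one_ofJ1728 :
    ∃ ψ ∈ (ofJ1728 ℚ).geomEndRing,
      ψ * ψ = ((-1 : ℤ) : AddMonoid.End (ofJ1728 ℚ).geomPoints) := by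
  obtain ⟨u, hu⟩ := IsAlgClosed.exists_pow_nat_eq (-1 : AlgebraicClosure ℚ) (n := 2) two_pos
  have hu0 : u ≠ 0 := by
    rintro rfl
    rw [zero_pow two_ne_zero, zero_eq_neg] at hu
    exact one_ne_zero hu
  have huinv : u⁻¹ = -u := inv_eq_of_mul_eq_one_right (by linear_combination -hu)
  set C : VariableChange (AlgebraicClosure ℚ) := ⟨Units.mk0 u hu0, 0, 0, 0⟩ with hC
  have h := smul_ofJ1728_eq hu hu0
  set ι : (ofJ1728 ℚ).geomPoints ≃+ (ofJ1728 ℚ).geomPoints :=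
    (VariableChange.pointEquiv ((ofJ1728 ℚ).baseChange (AlgebraicClosure ℚ)) C).trans
      (Affine.Point.congrEquiv h) with hι
  refine ⟨ι.toAddMonoidHom, toAddMonoidHom_pointEquiv_trans_congrEquiv_mem_geomEndRing C h, ?_⟩
  refine AddMonoidHom.ext fun P ↦ ?_
  change ι (ι P) = ((-1 : ℤ) : AddMonoid.End (ofJ1728 ℚ).geomPoints) P
  rw [AddMonoid.End.intCast_apply, neg_one_zsmul]
  rcases P with _ | ⟨x, y, hxy⟩
  · change ι (ι 0) = -0
    rw [map_zero, map_zero, neg_zero]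
  · have hxy' : ((ofJ1728 ℚ).baseChange (AlgebraicClosure ℚ)).toAffine.Nonsingular
        (C.toX x) (C.toY x y) :=
      h ▸ (VariableChange.nonsingular_iff ((ofJ1728 ℚ).baseChange (AlgebraicClosure ℚ)) C x y).mpr
        hxy
    have h1 : ι (Affine.Point.some x y hxy) = Affine.Point.some (C.toX x) (C.toY x y) hxy' :=
      pointEquiv_trans_congrEquiv_some C h hxy
    have hxy'' : ((ofJ1728 ℚ).baseChange (AlgebraicClosure ℚ)).toAffine.Nonsingular
        (C.toX (C.toX x)) (C.toY (C.toX x) (C.toY x y)) :=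
      h ▸ (VariableChange.nonsingular_iff ((ofJ1728 ℚ).baseChange (AlgebraicClosure ℚ)) C _ _).mpr
        hxy'
    have h2 : ι (Affine.Point.some (C.toX x) (C.toY x y) hxy') =
        Affine.Point.some (C.toX (C.toX x)) (C.toY (C.toX x) (C.toY x y)) hxy'' :=
      pointEquiv_trans_congrEquiv_some C h hxy'
    have hX : C.toX (C.toX x) = x := by
      simp only [VariableChange.toX_def, hC, Units.val_inv_eq_inv_val, Units.val_mk0, huinv,
        sub_zero]
      linear_combination (u ^ 2 - 1) * x * hu
    have hY : C.toY (C.toX x) (C.toY x y) =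
        ((ofJ1728 ℚ).baseChange (AlgebraicClosure ℚ)).toAffine.negY x y := by
      rw [baseChange_ofJ1728]
      simp only [VariableChange.toY_def, VariableChange.toX_def, hC, Units.val_inv_eq_inv_val,
        Units.val_mk0, huinv, sub_zero, zero_mul, Affine.negY, ofJ1728]
      linear_combination (u ^ 4 - u ^ 2 + 1) * y * hu
    rw [h1]
    refine h2.trans ?_
    have key : ∀ {a b : AlgebraicClosure ℚ}
        (hab : ((ofJ1728 ℚ).baseChange (AlgebraicClosure ℚ)).toAffine.Nonsingular a b),
        a = x → b = ((ofJ1728 ℚ).baseChange (AlgebraicClosure ℚ)).toAffine.negY x y →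
          Affine.Point.some a b hab = -Affine.Point.some x y hxy := by
      rintro a b hab rfl rfl
      rfl
    exact key hxy'' hX hY

/-! ## §2 Every curve with `j = 1728` carries `ψ` with `ψ² = [−1]` -/

/-- **`j(W) = 1728 ⟹ ∃ ψ ∈ End_{ℚ̄}(W), ψ² = [−1]`**: `W_{ℚ̄} ≅ (y² = x³ + x)_{ℚ̄}` (same `j`,
Silverman *AEC* III.1.4(b)), and a `ℚ̄`-isomorphism conjugates the geometric endomorphism rings
(`exists_ringEquiv_geomEndRing_of_j_eq`), carrying `[i]` to such a `ψ`.
[cite: SilvermanAEC2009, Prop. III.1.4(b) and III Example 4.4] -/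
theorem exists_sq_eq_neg_one_of_j_eq_1728 (W : WeierstrassCurve ℚ) [W.IsElliptic]
    (hj : W.j = 1728) :
    ∃ ψ ∈ W.geomEndRing, ψ * ψ = ((-1 : ℤ) : AddMonoid.End W.geomPoints) := by
  haveI := fact_isUnit_two_rat
  obtain ⟨ψ, hψ, hψψ⟩ := exists_sq_eq_neg_one_ofJ1728
  obtain ⟨e, -⟩ := exists_ringEquiv_geomEndRing_of_j_eq (V₁ := W) (V₂ := ofJ1728 ℚ)
    (by rw [hj, ofJ1728_j])
  have h1 : (⟨ψ, hψ⟩ : (ofJ1728 ℚ).geomEndRing) * ⟨ψ, hψ⟩ = ((-1 : ℤ) : (ofJ1728 ℚ).geomEndRing) :=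
    Subtype.ext (by push_cast; exact_mod_cast hψψ)
  have h2 : e ⟨ψ, hψ⟩ * e ⟨ψ, hψ⟩ = ((-1 : ℤ) : W.geomEndRing) := by
    rw [← map_mul, h1, map_intCast]
  refine ⟨(e ⟨ψ, hψ⟩ : W.geomEndRing), (e ⟨ψ, hψ⟩).2, ?_⟩
  have h3 := congrArg Subtype.val h2
  simpa using h3

/-! ## §3 The frame `(P, φP)` and the shear obstruction -/

section Frame

variable {V : Type*} [AddCommGroup V]

/-- In an abelian group killed by `3`, `n • P = 0` with `3 ∤ n` forces `P = 0`. [folklore] -/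
theorem eq_zero_of_nsmul_eq_zero_of_not_three_dvd {P : V} (h3 : 3 • P = 0) {n : ℕ}
    (hn : n • P = 0) (hnd : ¬ 3 ∣ n) : P = 0 := by
  have hmod : (n % 3) • P = 0 := by
    have hsplit : n • P = (n / 3) • (3 • P) + (n % 3) • P := by
      have hn3 : n = n / 3 * 3 + n % 3 := (Nat.div_add_mod' n 3).symm
      conv_lhs => rw [hn3]
      rw [add_nsmul, ← smul_smul]
    rw [hsplit, h3, nsmul_zero, zero_add] at hn
    exact hn
  have hlt : n % 3 < 3 := Nat.mod_lt n (by norm_num)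
  have hne : n % 3 ≠ 0 := fun h0 ↦ hnd (Nat.dvd_of_mod_eq_zero h0)
  interval_cases hm : n % 3
  · exact absurd rfl hne
  · rwa [one_nsmul] at hmod
  · -- `2 • P = 0` and `3 • P = 0`
    have : P = 3 • P - 2 • P := by rw [succ_nsmul, add_sub_cancel_left]
    rw [this, h3, hmod, sub_zero]

/-- **The frame lemma.**  Let `φ` be an additive endomorphism of an abelian group `V` killed by `3`
with `φ(φ P) = −P`, and `P ≠ 0`.  If `a • P + b • φ P = 0` for naturals `a, b < 3` then `a = b = 0`:
applying `φ` gives `a • φP − b • P = 0`, and `a·(first) − b·(second) = (a² + b²) • P = 0`, while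
`3 ∤ a² + b²` unless `a = b = 0`. [folklore] -/
theorem frame_eq_zero (φ : V →+ V) (h3 : ∀ R : V, 3 • R = 0) {P : V} (hP : P ≠ 0)
    (hφφ : φ (φ P) = -P) {a b : ℕ} (ha : a < 3) (hb : b < 3) (hab : a • P + b • φ P = 0) :
    a = 0 ∧ b = 0 := by
  have hab' : a • φ P - b • P = 0 := by
    have := congrArg φ hab
    rw [map_add, map_nsmul, map_nsmul, hφφ, map_zero, smul_neg, ← sub_eq_add_neg] at this
    exact this
  have hsq : (a * a + b * b) • P = 0 := by
    have hcalc : ((a * a + b * b : ℕ) : ℤ) • P =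
        (a : ℤ) • (a • P + b • φ P) - (b : ℤ) • (a • φ P - b • P) := by
      simp only [← natCast_zsmul]
      push_cast
      module
    rw [hab, hab', smul_zero, smul_zero, sub_zero, natCast_zsmul] at hcalc
    exact hcalc
  have hdvd : 3 ∣ a * a + b * b := by
    by_contra hnd
    exact hP (eq_zero_of_nsmul_eq_zero_of_not_three_dvd (h3 P) hsq hnd)
  interval_cases a <;> interval_cases b <;> omega

end Frame

/-- **No elliptic curve over `ℚ` with `j = 1728` has `ρ̄_{E,3}` onto** (`¬ Surj W 3`).  See the
module docstring: `φ = [i]|_{E[3]}` has `φ² = −1` and `φσ = ±σφ` (`σ ∈ Γ_ℚ`, Lang's Remark), the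
pair `(P, φP)` frames `E[3]`, and the shear `σP = P, σ(φP) = P + φP` — which an onto `ρ̄_{E,3}`
would supply (`X9.exists_smul_eq_shear_of_hasSurjectiveModNGaloisRep`) — is incompatible with
`φσ = ±σφ`.  (The image lies in the normaliser of a Cartan subgroup of `GL₂(𝔽₃)`.)
[cite: Lang1987, Ch. 10 §4, Remark] [cite: SilvermanAEC2009, III Example 4.4] [cite: Serre1972, §4.5] -/
theorem not_surj_three_of_j_eq_1728 (W : WeierstrassCurve ℚ) [W.IsElliptic] (hj : W.j = 1728) :
    ¬ Surj W 3 := by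
  intro hsurj
  obtain ⟨ψ, hψ, hψψ⟩ := exists_sq_eq_neg_one_of_j_eq_1728 W hj
  obtain ⟨χ, -, hrel⟩ := exists_quadraticTwist_of_sq_eq_intCast W hψ (D := -1) (by norm_num) hψψ
  obtain ⟨φ, -, hφφ, hφrel⟩ := exists_restrict_geomTorsion_of_twist W hψψ hrel ((3 : ℕ) : ℤ)
  -- `E[3]` has `9` elements; pick `P ≠ 0`
  have hcard : Nat.card (W.geomTorsion ((3 : ℕ) : ℤ)) = 9 := by
    have := natCard_torsionBy_geomPoints (W := W) (n := ((3 : ℕ) : ℤ)) (by norm_num)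
    simpa using this
  haveI : Finite (W.geomTorsion ((3 : ℕ) : ℤ)) := Nat.finite_of_card_ne_zero (by rw [hcard]; norm_num)
  haveI : Nontrivial (W.geomTorsion ((3 : ℕ) : ℤ)) :=
    (Finite.one_lt_card_iff_nontrivial).mp (by rw [hcard]; norm_num)
  obtain ⟨P, hP0⟩ := exists_ne (0 : W.geomTorsion ((3 : ℕ) : ℤ))
  have h3 : ∀ R : W.geomTorsion ((3 : ℕ) : ℤ), 3 • R = 0 := fun R ↦ by
    have hR := R.2
    rw [Submodule.mem_toAddSubgroup, Submodule.mem_torsionBy_iff] at hR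
    apply Subtype.ext
    have : ((3 : ℤ) • (R : W.geomPoints)) = 0 := by exact_mod_cast hR
    rw [show (3 : ℤ) = ((3 : ℕ) : ℤ) by norm_num, natCast_zsmul] at this
    exact_mod_cast this
  have hφφP : φ (φ P) = -P := by rw [hφφ, neg_one_zsmul]
  -- the frame `(x, y) ↦ x P + y φP`
  set Q : W.geomTorsion ((3 : ℕ) : ℤ) := φ P with hQ
  let L : ZMod 3 × ZMod 3 → W.geomTorsion ((3 : ℕ) : ℤ) := fun xy ↦ xy.1.val • P + xy.2.val • Q
  have hL : ∀ xy, (L xy : geomPoints W) =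
      xy.1.val • (P : geomPoints W) + xy.2.val • (Q : geomPoints W) := fun xy ↦ by
    simp only [L, AddSubgroup.coe_add, AddSubgroupClass.coe_nsmul]
  have hLadd : ∀ xy zw, L (xy + zw) = L xy + L zw := fun xy zw ↦ by
    apply Subtype.ext
    simp only [L, AddSubgroup.coe_add, AddSubgroupClass.coe_nsmul]
    exact X9.val_smul_frame_add W P.2 Q.2 xy zw
  have hLzero : ∀ xy, L xy = 0 → xy = 0 := fun xy hxy ↦ by
    obtain ⟨ha, hb⟩ := frame_eq_zero (φ : W.geomTorsion ((3 : ℕ) : ℤ) →+ _) h3 hP0 hφφP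
      (ZMod.val_lt xy.1) (ZMod.val_lt xy.2) hxy
    exact Prod.ext ((ZMod.val_eq_zero _).mp ha) ((ZMod.val_eq_zero _).mp hb)
  have hLinj : Function.Injective L := fun xy zw hEq ↦ by
    have hsub : L (xy - zw) = 0 := by
      have := hLadd (xy - zw) zw
      rw [sub_add_cancel] at this
      rw [hEq] at this
      exact (add_eq_right.mp this.symm)
    exact sub_eq_zero.mp (hLzero _ hsub)
  have hLbij : Function.Bijective L := by
    refine hLinj.bijective_of_nat_card_le ?_
    rw [hcard, Nat.card_prod, Nat.card_zmod]
  -- an onto `ρ̄_{E,3}` supplies the shear `σ P = P`, `σ Q = P + Q`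
  obtain ⟨σ, hσP, hσQ⟩ := X9.exists_smul_eq_shear_of_hasSurjectiveModNGaloisRep W (m := 3)
    (by norm_num) hsurj P.2 Q.2 L hL hLbij
  have hσP' : σ • P = P := Subtype.ext (by rw [AddSubgroup.torsionBy.coe_smul]; exact hσP)
  have hσQ' : σ • Q = P + Q :=
    Subtype.ext (by rw [AddSubgroup.torsionBy.coe_smul, AddSubgroup.coe_add]; exact hσQ)
  -- `φ P = χ(σ) • σ (φ P) = ±(P + Q)`
  have hkey : Q = ((χ σ : ℤˣ) : ℤ) • (P + Q) := by
    have := hφrel σ P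
    rw [hσP', ← hQ, hσQ'] at this
    exact this
  rcases Int.units_eq_one_or (χ σ) with hε | hε
  · rw [hε, Units.val_one, one_zsmul] at hkey
    exact hP0 (add_eq_right.mp hkey.symm)
  · rw [hε, Units.val_neg, Units.val_one, neg_one_zsmul, neg_add] at hkey
    -- `Q = -P - Q`, i.e. `1 • P + 2 • Q = 0`
    have h12 : L ((1 : ZMod 3), (2 : ZMod 3)) = 0 := by
      change (1 : ZMod 3).val • P + (2 : ZMod 3).val • Q = 0
      rw [show (1 : ZMod 3).val = 1 from rfl, show (2 : ZMod 3).val = 2 from rfl, one_nsmul,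
        two_nsmul]
      calc P + (Q + Q) = P + (Q + (-P + -Q)) := by rw [← hkey]
        _ = 0 := by abel
    have := hLzero _ h12
    simp at this

/-- **Contrapositive for the X4 side: `Surj W 3 ⟹ j(W) ≠ 1728`.** [cite: Lang1987, Ch. 10 §4, Remark] -/
theorem j_ne_1728_of_surj_three (W : WeierstrassCurve ℚ) [W.IsElliptic] (hsurj : Surj W 3) :
    W.j ≠ 1728 := fun hj ↦ not_surj_three_of_j_eq_1728 W hj hsurj

end Summit.BirchSwinnertonDyer.Rank1Residual.GaloisImage

end
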